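import Summits.Ventures.WeilGRH.ReflectionInequalityBeyondCore
import HarnessLib

/-!
# GRH arm (rh-explicit, venture WeilGRH): the reflection inequality BEYOND the shift (`L ≤ a < 3L/2`)

`ReflectionInequalityAt.lean` treats a shift `L` with `a ≤ L < 2a` (pairs `{x, x − L}`). For `L ≤ a < 3L/2`
(the `ζ` frontier `a = 4023/5000` with `L = log 2`) the fibres of `x ↦ x − L` on `[-a, a]` are PAIRS
(`x ∈ (a − L, 2L − a)`) and TRIPLES `{x, x − L, x − 2L}` (`x ∈ [2L − a, a]`), and the doubled shift `2L`
(the prime power `4 = 2²`) joins the ends of each triple. With an `LDL*` datum `(p, r, s, d₂, d₃)` of the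
triple form `B Σ|vᵢ|² + 2κRe(ω v₁v̄₂) + 2κRe(ω v₂v̄₃) + 2κ'Re(ω' v₁v̄₃)` (`triangle_form_ldl`), the core
estimate of `ReflectionInequalityBeyondCore.lean` becomes the **reflection inequality beyond the shift**

`|c|² ≤ (B‖g‖₂² + 2κ Re(ω k(L)) + 2κ' Re(ω' k(2L))) · G`,
`G = (C_P + Re ω·I_P)/(B+κ) + (C_P − Re ω·I_P)/(B−κ) + J₁₁/B + Z₂/d₂ + Z₃/d₃`,

`C_P, I_P` the pair integrals over `[a−L, 2L−a]`, `J_{ij} = ∫_{2L−a}^{a} ηᵢηⱼ` (`η = (ch(x), ch(x−L), ch(x−2L))`),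
`Z₂ = J₂₂ − 2Re(p)J₁₂ + |p|²J₁₁`, `Z₃ = J₃₃ + |s|²J₂₂ + |e|²J₁₁ − 2Re(s)J₂₃ + 2Re(e)J₁₃ − 2Re(s ē)J₁₂`, `e = ps − r`
(closed forms: `integral_cosh_half_sq`, `integral_cosh_half_sub_sq`, `integral_cosh_half_sub_mul`). Used by
`FrontierDoubleTransfer.lean`. References: A. Weil (1952), (11) and the «lemme» p. 262; H. Yoshida (1992) §6.
-/

noncomputable section

open Complex Filter Set MeasureTheory
open scoped Real Topology ComplexConjugate

namespace Summit.Ventures.WeilGRH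

open Literature.NumberTheory.LFunctions

variable {g : ℝ → ℂ}

/-! ## Identification of the energy `W'` -/

/-- Pairs: `½[(B+κ)∫|ωg + g(·−L)|² + (B−κ)∫|ωg − g(·−L)|²] = B(∫|g|² + ∫|g(·−L)|²) + 2κ∫Re(ω g ḡ(·−L))`.
[folklore] -/
theorem pair_energy_identity (hgc : Continuous g) {ω : ℂ} (hω : ‖ω‖ = 1) (L u v B κ : ℝ) :
    ((B + κ) * (∫ x in u..v, ‖ω * g x + g (x - L)‖ ^ 2) +
        (B - κ) * (∫ x in u..v, ‖ω * g x - g (x - L)‖ ^ 2)) / 2 =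
      B * ((∫ x in u..v, ‖g x‖ ^ 2) + ∫ x in u..v, ‖g (x - L)‖ ^ 2) +
        2 * κ * ∫ x in u..v, (ω * (g x * conj (g (x - L)))).re := by
  have hgL : Continuous fun x ↦ g (x - L) := hgc.comp (continuous_id.sub continuous_const)
  have iYp : IntervalIntegrable (fun x ↦ ‖ω * g x + g (x - L)‖ ^ 2) volume u v :=
    (by fun_prop : Continuous fun x ↦ ‖ω * g x + g (x - L)‖ ^ 2).intervalIntegrable _ _
  have iYm : IntervalIntegrable (fun x ↦ ‖ω * g x - g (x - L)‖ ^ 2) volume u v :=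
    (by fun_prop : Continuous fun x ↦ ‖ω * g x - g (x - L)‖ ^ 2).intervalIntegrable _ _
  have iN : IntervalIntegrable (fun x ↦ ‖g x‖ ^ 2) volume u v :=
    (hgc.norm.pow 2).intervalIntegrable _ _
  have iN' : IntervalIntegrable (fun x ↦ ‖g (x - L)‖ ^ 2) volume u v :=
    (hgL.norm.pow 2).intervalIntegrable _ _
  have hYsum : (∫ x in u..v, ‖ω * g x + g (x - L)‖ ^ 2) + (∫ x in u..v, ‖ω * g x - g (x - L)‖ ^ 2) =
      2 * ((∫ x in u..v, ‖g x‖ ^ 2) + ∫ x in u..v, ‖g (x - L)‖ ^ 2) := by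
    rw [← intervalIntegral.integral_add iYp iYm, ← intervalIntegral.integral_add iN iN',
      ← intervalIntegral.integral_const_mul]
    exact intervalIntegral.integral_congr fun x _ ↦ normSq_reflectPair_add hω _ _
  have hYdiff : (∫ x in u..v, ‖ω * g x + g (x - L)‖ ^ 2) - (∫ x in u..v, ‖ω * g x - g (x - L)‖ ^ 2) =
      4 * ∫ x in u..v, (ω * (g x * conj (g (x - L)))).re := by
    rw [← intervalIntegral.integral_sub iYp iYm, ← intervalIntegral.integral_const_mul]
    exact intervalIntegral.integral_congr fun x _ ↦ normSq_reflectPair_sub _ _ _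
  linear_combination (B / 2) * hYsum + (κ / 2) * hYdiff

/-- Triples: `B∫|u₁|² + d₂∫|u₂|² + d₃∫|u₃|²` equals the triple form integrated, under the `LDL*` identities.
[folklore] -/
theorem triple_energy_identity (hgc : Continuous g) {B d₂ d₃ κ κ' : ℝ} {p r s ω ω' : ℂ}
    (hI : B * ‖p‖ ^ 2 + d₂ = B) (hII : B * ‖r‖ ^ 2 + d₂ * ‖s‖ ^ 2 + d₃ = B)
    (hIII : (B : ℂ) * conj p = κ * ω) (hIV : (B : ℂ) * conj r = κ' * ω')
    (hV : (B : ℂ) * p * conj r + d₂ * conj s = κ * ω) (L u v : ℝ) :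
    B * (∫ x in u..v, ‖g x + p * g (x - L) + r * g (x - 2 * L)‖ ^ 2) +
        d₂ * (∫ x in u..v, ‖g (x - L) + s * g (x - 2 * L)‖ ^ 2) +
        d₃ * (∫ x in u..v, ‖g (x - 2 * L)‖ ^ 2) =
      B * ((∫ x in u..v, ‖g x‖ ^ 2) + (∫ x in u..v, ‖g (x - L)‖ ^ 2) +
          ∫ x in u..v, ‖g (x - 2 * L)‖ ^ 2) +
        2 * κ * ((∫ x in u..v, (ω * (g x * conj (g (x - L)))).re) +
          ∫ x in u..v, (ω * (g (x - L) * conj (g (x - 2 * L)))).re) +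
        2 * κ' * ∫ x in u..v, (ω' * (g x * conj (g (x - 2 * L)))).re := by
  have hgL : Continuous fun x ↦ g (x - L) := hgc.comp (continuous_id.sub continuous_const)
  have hg2L : Continuous fun x ↦ g (x - 2 * L) := hgc.comp (continuous_id.sub continuous_const)
  have iU1 : IntervalIntegrable (fun x ↦ B * ‖g x + p * g (x - L) + r * g (x - 2 * L)‖ ^ 2) volume u v :=
    (by fun_prop : Continuous fun x ↦ B * ‖g x + p * g (x - L) + r * g (x - 2 * L)‖ ^ 2).intervalIntegrable _ _
  have iU2 : IntervalIntegrable (fun x ↦ d₂ * ‖g (x - L) + s * g (x - 2 * L)‖ ^ 2) volume u v :=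
    (by fun_prop : Continuous fun x ↦ d₂ * ‖g (x - L) + s * g (x - 2 * L)‖ ^ 2).intervalIntegrable _ _
  have iU3 : IntervalIntegrable (fun x ↦ d₃ * ‖g (x - 2 * L)‖ ^ 2) volume u v :=
    (by fun_prop : Continuous fun x ↦ d₃ * ‖g (x - 2 * L)‖ ^ 2).intervalIntegrable _ _
  have iN1 : IntervalIntegrable (fun x ↦ ‖g x‖ ^ 2) volume u v := (hgc.norm.pow 2).intervalIntegrable _ _
  have iN2 : IntervalIntegrable (fun x ↦ ‖g (x - L)‖ ^ 2) volume u v :=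
    (hgL.norm.pow 2).intervalIntegrable _ _
  have iN3 : IntervalIntegrable (fun x ↦ ‖g (x - 2 * L)‖ ^ 2) volume u v :=
    (hg2L.norm.pow 2).intervalIntegrable _ _
  have lhs : B * (∫ x in u..v, ‖g x + p * g (x - L) + r * g (x - 2 * L)‖ ^ 2) +
        d₂ * (∫ x in u..v, ‖g (x - L) + s * g (x - 2 * L)‖ ^ 2) +
        d₃ * (∫ x in u..v, ‖g (x - 2 * L)‖ ^ 2) =
      ∫ x in u..v, (B * ‖g x + p * g (x - L) + r * g (x - 2 * L)‖ ^ 2 +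
        d₂ * ‖g (x - L) + s * g (x - 2 * L)‖ ^ 2 + d₃ * ‖g (x - 2 * L)‖ ^ 2) := by
    rw [← intervalIntegral.integral_const_mul, ← intervalIntegral.integral_const_mul,
      ← intervalIntegral.integral_const_mul, ← intervalIntegral.integral_add iU1 iU2,
      ← intervalIntegral.integral_add (iU1.add iU2) iU3]
  have j1 : IntervalIntegrable (fun x ↦ B * (‖g x‖ ^ 2 + ‖g (x - L)‖ ^ 2 + ‖g (x - 2 * L)‖ ^ 2))
      volume u v :=
    (by fun_prop : Continuous fun x ↦
      B * (‖g x‖ ^ 2 + ‖g (x - L)‖ ^ 2 + ‖g (x - 2 * L)‖ ^ 2)).intervalIntegrable _ _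
  have j2 : IntervalIntegrable (fun x ↦ 2 * κ * (ω * (g x * conj (g (x - L)))).re) volume u v :=
    (by fun_prop : Continuous fun x ↦ 2 * κ * (ω * (g x * conj (g (x - L)))).re).intervalIntegrable _ _
  have j3 : IntervalIntegrable (fun x ↦ 2 * κ * (ω * (g (x - L) * conj (g (x - 2 * L)))).re)
      volume u v :=
    (by fun_prop : Continuous fun x ↦
      2 * κ * (ω * (g (x - L) * conj (g (x - 2 * L)))).re).intervalIntegrable _ _
  have j4 : IntervalIntegrable (fun x ↦ 2 * κ' * (ω' * (g x * conj (g (x - 2 * L)))).re)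
      volume u v :=
    (by fun_prop : Continuous fun x ↦
      2 * κ' * (ω' * (g x * conj (g (x - 2 * L)))).re).intervalIntegrable _ _
  have rhs : B * ((∫ x in u..v, ‖g x‖ ^ 2) + (∫ x in u..v, ‖g (x - L)‖ ^ 2) +
          ∫ x in u..v, ‖g (x - 2 * L)‖ ^ 2) +
        2 * κ * ((∫ x in u..v, (ω * (g x * conj (g (x - L)))).re) +
          ∫ x in u..v, (ω * (g (x - L) * conj (g (x - 2 * L)))).re) +
        2 * κ' * ∫ x in u..v, (ω' * (g x * conj (g (x - 2 * L)))).re =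
      ∫ x in u..v, (B * (‖g x‖ ^ 2 + ‖g (x - L)‖ ^ 2 + ‖g (x - 2 * L)‖ ^ 2) +
        2 * κ * (ω * (g x * conj (g (x - L)))).re +
        2 * κ * (ω * (g (x - L) * conj (g (x - 2 * L)))).re +
        2 * κ' * (ω' * (g x * conj (g (x - 2 * L)))).re) := by
    rw [intervalIntegral.integral_add ((j1.add j2).add j3) j4,
      intervalIntegral.integral_add (j1.add j2) j3, intervalIntegral.integral_add j1 j2,
      intervalIntegral.integral_const_mul, intervalIntegral.integral_const_mul,
      intervalIntegral.integral_const_mul, intervalIntegral.integral_const_mul,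
      intervalIntegral.integral_add (iN1.add iN2) iN3, intervalIntegral.integral_add iN1 iN2]
    ring
  rw [lhs, rhs]
  refine intervalIntegral.integral_congr fun x _ ↦ ?_
  have := triangle_form_ldl hI hII hIII hIV hV (g x) (g (x - L)) (g (x - 2 * L))
  linarith

/-! ## The prime correlations as window integrals -/

/-- `Re(ω·k(L))` split over the three sub-intervals of `[L − a, a]`, the first one shifted onto the triple
domain: `∫_{2L−a}^{a} Re(ω g(x−L)ḡ(x−2L)) + ∫_{a−L}^{2L−a} Re(ω g ḡ(·−L)) + ∫_{2L−a}^{a} Re(ω g ḡ(·−L))`.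
[folklore] -/
theorem re_mul_weilConv_split (hg : IsWeilTest g) {L a : ℝ} (hsupp : tsupport g ⊆ Icc (-a) a)
    (hLa : L ≤ a) (h3L : 2 * a < 3 * L) (ω : ℂ) {m' : ℝ} (hm' : m' = 2 * L - a) :
    (∫ x in m'..a, (ω * (g (x - L) * conj (g (x - 2 * L)))).re) +
        ((∫ x in (a - L)..m', (ω * (g x * conj (g (x - L)))).re) +
          ∫ x in m'..a, (ω * (g x * conj (g (x - L)))).re) =
      (ω * weilConv g (weilReflect g) L).re := by
  have hgc : Continuous g := hg.1.continuous
  have hz : ∀ x, x ∉ Icc (-a) a → g x = 0 := fun x hx ↦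
    image_eq_zero_of_notMem_tsupport fun h ↦ hx (hsupp h)
  have hcs : HasCompactSupport fun x ↦ ω * (g x * conj (g (x - L))) :=
    (hg.2.mul_right (f' := fun x ↦ conj (g (x - L)))).mul_left
  have hInt : Integrable fun x ↦ ω * (g x * conj (g (x - L))) :=
    (by fun_prop : Continuous fun x ↦ ω * (g x * conj (g (x - L)))).integrable_of_hasCompactSupport hcs
  have hre := integral_re hInt
  simp only [RCLike.re_to_complex] at hre
  have hwhole : (∫ x, (ω * (g x * conj (g (x - L)))).re) =
      ∫ x in (L - a)..a, (ω * (g x * conj (g (x - L)))).re := by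
    refine integral_eq_intervalIntegral_of_zero_off (by linarith) fun x hx ↦ ?_
    rw [mem_Icc, not_and_or, not_le, not_le] at hx
    rcases hx with hx | hx
    · have : g (x - L) = 0 := hz _ fun h ↦ by
        rw [mem_Icc] at h
        linarith [h.1]
      simp [this]
    · have : g x = 0 := hz _ fun h ↦ by
        rw [mem_Icc] at h
        linarith [h.2]
      simp [this]
  have icont : Continuous fun x ↦ (ω * (g x * conj (g (x - L)))).re := by fun_prop
  have hshift : (∫ x in m'..a, (ω * (g (x - L) * conj (g (x - 2 * L)))).re) =
      ∫ x in (L - a)..(a - L), (ω * (g x * conj (g (x - L)))).re := by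
    have e := intervalIntegral.integral_comp_sub_right
      (fun x ↦ (ω * (g x * conj (g (x - L)))).re) L (a := m') (b := a)
    rw [show m' - L = L - a by rw [hm']; ring] at e
    rw [← e]
    refine intervalIntegral.integral_congr fun x _ ↦ ?_
    simp only [sub_sub, ← two_mul]
  rw [weilConv_weilReflect_apply_eq, ← integral_const_mul, ← hre, hwhole, hshift,
    ← intervalIntegral.integral_add_adjacent_intervals (icont.intervalIntegrable (L - a) (a - L))
      (icont.intervalIntegrable (a - L) a),
    ← intervalIntegral.integral_add_adjacent_intervals (icont.intervalIntegrable (a - L) m')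
      (icont.intervalIntegrable m' a)]

/-- `Re(ω'·k(2L)) = ∫_{2L−a}^{a} Re(ω' g(x) ḡ(x − 2L))` (support). [folklore] -/
theorem re_mul_weilConv_two_shift (hg : IsWeilTest g) {L a : ℝ} (hsupp : tsupport g ⊆ Icc (-a) a)
    (hLa : L ≤ a) (ω' : ℂ) {m' : ℝ} (hm' : m' = 2 * L - a) :
    (∫ x in m'..a, (ω' * (g x * conj (g (x - 2 * L)))).re) =
      (ω' * weilConv g (weilReflect g) (2 * L)).re := by
  have hgc : Continuous g := hg.1.continuous
  have hz : ∀ x, x ∉ Icc (-a) a → g x = 0 := fun x hx ↦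
    image_eq_zero_of_notMem_tsupport fun h ↦ hx (hsupp h)
  have hcs : HasCompactSupport fun x ↦ ω' * (g x * conj (g (x - 2 * L))) :=
    (hg.2.mul_right (f' := fun x ↦ conj (g (x - 2 * L)))).mul_left
  have hInt : Integrable fun x ↦ ω' * (g x * conj (g (x - 2 * L))) :=
    (by fun_prop : Continuous fun x ↦
      ω' * (g x * conj (g (x - 2 * L)))).integrable_of_hasCompactSupport hcs
  have hre := integral_re hInt
  simp only [RCLike.re_to_complex] at hre
  rw [weilConv_weilReflect_apply_eq, ← integral_const_mul, ← hre]
  refine (integral_eq_intervalIntegral_of_zero_off (by rw [hm']; linarith) fun x hx ↦ ?_).symm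
  rw [mem_Icc, not_and_or, not_le, not_le] at hx
  rcases hx with hx | hx
  · have : g (x - 2 * L) = 0 := hz _ fun h ↦ by
      rw [mem_Icc] at h
      rw [hm'] at hx
      linarith [h.1]
    simp [this]
  · have : g x = 0 := hz _ fun h ↦ by
      rw [mem_Icc] at h
      linarith [h.2]
    simp [this]

/-- `‖g‖₂²` split over the five sub-intervals, the shifted ones transported onto the pair / triple domains.
[folklore] -/
theorem normSq_integral_split_five (hg : IsWeilTest g) {L a : ℝ} (hsupp : tsupport g ⊆ Icc (-a) a)
    (hL : 0 < L) (hLa : L ≤ a) {m' : ℝ} (hm' : m' = 2 * L - a) :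
    ∫ x, ‖g x‖ ^ 2 = (∫ x in m'..a, ‖g (x - 2 * L)‖ ^ 2) + ((∫ x in (a - L)..m', ‖g (x - L)‖ ^ 2) +
      ((∫ x in m'..a, ‖g (x - L)‖ ^ 2) + ((∫ x in (a - L)..m', ‖g x‖ ^ 2) + ∫ x in m'..a, ‖g x‖ ^ 2))) := by
  have hgc : Continuous g := hg.1.continuous
  have hz : ∀ x, x ∉ Icc (-a) a → g x = 0 := fun x hx ↦
    image_eq_zero_of_notMem_tsupport fun h ↦ hx (hsupp h)
  have hii2 : ∀ u v : ℝ, IntervalIntegrable (fun x ↦ ‖g x‖ ^ 2) volume u v :=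
    fun u v ↦ (hgc.norm.pow 2).intervalIntegrable u v
  rw [integral_eq_intervalIntegral_of_zero_off (lo := -a) (hi := a) (by linarith)
      (fun x hx ↦ by simp [hz x hx]),
    ← intervalIntegral.integral_add_adjacent_intervals (hii2 (-a) (a - 2 * L)) (hii2 (a - 2 * L) a),
    ← intervalIntegral.integral_add_adjacent_intervals (hii2 (a - 2 * L) (L - a)) (hii2 (L - a) a),
    ← intervalIntegral.integral_add_adjacent_intervals (hii2 (L - a) (a - L)) (hii2 (a - L) a),
    ← intervalIntegral.integral_add_adjacent_intervals (hii2 (a - L) m') (hii2 m' a),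
    intervalIntegral.integral_comp_sub_right (fun x ↦ ‖g x‖ ^ 2) (2 * L),
    intervalIntegral.integral_comp_sub_right (fun x ↦ ‖g x‖ ^ 2) L,
    intervalIntegral.integral_comp_sub_right (fun x ↦ ‖g x‖ ^ 2) L,
    show m' - 2 * L = -a by rw [hm']; ring, show a - L - L = a - 2 * L by ring,
    show m' - L = L - a by rw [hm']; ring]

/-! ## Identification of the dual factor `G'` -/

/-- Pairs: `∫|ω̄ch(x) ± ch(L−x)|² = 2C_P ± 2Re(ω)I_P` on an interval symmetric about `L/2`. [folklore] -/
theorem pair_dual_identity {ω : ℂ} (hω : ‖ω‖ = 1) {L u v : ℝ} (huv : u + v = L) :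
    (∫ x in u..v, ‖conj ω * (Real.cosh (x / 2) : ℂ) + (Real.cosh ((L - x) / 2) : ℂ)‖ ^ 2) =
        2 * (∫ x in u..v, Real.cosh (x / 2) ^ 2) +
          2 * ω.re * (∫ x in u..v, Real.cosh (x / 2) * Real.cosh ((L - x) / 2)) ∧
    (∫ x in u..v, ‖conj ω * (Real.cosh (x / 2) : ℂ) - (Real.cosh ((L - x) / 2) : ℂ)‖ ^ 2) =
        2 * (∫ x in u..v, Real.cosh (x / 2) ^ 2) -
          2 * ω.re * (∫ x in u..v, Real.cosh (x / 2) * Real.cosh ((L - x) / 2)) := by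
  have hσ : ∫ x in u..v, Real.cosh ((L - x) / 2) ^ 2 = ∫ x in u..v, Real.cosh (x / 2) ^ 2 := by
    have e1 := intervalIntegral.integral_comp_sub_left (fun y ↦ Real.cosh (y / 2) ^ 2) L (a := u) (b := v)
    rw [show L - u = v by linarith, show L - v = u by linarith] at e1
    exact e1
  have ic : IntervalIntegrable (fun x ↦ Real.cosh (x / 2) ^ 2) volume u v :=
    (by fun_prop : Continuous fun x ↦ Real.cosh (x / 2) ^ 2).intervalIntegrable _ _
  have icσ : IntervalIntegrable (fun x ↦ Real.cosh ((L - x) / 2) ^ 2) volume u v :=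
    (by fun_prop : Continuous fun x ↦ Real.cosh ((L - x) / 2) ^ 2).intervalIntegrable _ _
  have ii : IntervalIntegrable (fun x ↦ 2 * ω.re * Real.cosh (x / 2) * Real.cosh ((L - x) / 2)) volume u v :=
    (by fun_prop : Continuous fun x ↦
      2 * ω.re * Real.cosh (x / 2) * Real.cosh ((L - x) / 2)).intervalIntegrable _ _
  have hI2 : ∫ x in u..v, 2 * ω.re * Real.cosh (x / 2) * Real.cosh ((L - x) / 2) =
      2 * ω.re * ∫ x in u..v, Real.cosh (x / 2) * Real.cosh ((L - x) / 2) := by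
    rw [← intervalIntegral.integral_const_mul]
    exact intervalIntegral.integral_congr fun x _ ↦ by ring
  constructor
  · have : (∫ x in u..v, ‖conj ω * (Real.cosh (x / 2) : ℂ) + (Real.cosh ((L - x) / 2) : ℂ)‖ ^ 2) =
        ∫ x in u..v, (Real.cosh (x / 2) ^ 2 + Real.cosh ((L - x) / 2) ^ 2 +
          2 * ω.re * Real.cosh (x / 2) * Real.cosh ((L - x) / 2)) :=
      intervalIntegral.integral_congr fun x _ ↦ (normSq_conj_mul_add_real hω _ _).1
    rw [this, intervalIntegral.integral_add (ic.add icσ) ii, intervalIntegral.integral_add ic icσ, hσ, hI2]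
    ring
  · have : (∫ x in u..v, ‖conj ω * (Real.cosh (x / 2) : ℂ) - (Real.cosh ((L - x) / 2) : ℂ)‖ ^ 2) =
        ∫ x in u..v, (Real.cosh (x / 2) ^ 2 + Real.cosh ((L - x) / 2) ^ 2 -
          2 * ω.re * Real.cosh (x / 2) * Real.cosh ((L - x) / 2)) :=
      intervalIntegral.integral_congr fun x _ ↦ (normSq_conj_mul_add_real hω _ _).2
    rw [this, intervalIntegral.integral_sub (ic.add icσ) ii, intervalIntegral.integral_add ic icσ, hσ, hI2]
    ring

/-- Triples: the three dual integrals in terms of `J₁₁, J₂₂, J₃₃, J₁₂, J₁₃, J₂₃`. [folklore] -/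
theorem triple_dual_identity (p r s : ℂ) (L u v : ℝ) :
    (∫ x in u..v, ‖(Real.cosh (x / 2) : ℂ)‖ ^ 2) = (∫ x in u..v, Real.cosh (x / 2) ^ 2) ∧
    (∫ x in u..v, ‖(Real.cosh ((x - L) / 2) : ℂ) - p * (Real.cosh (x / 2) : ℂ)‖ ^ 2) =
      (∫ x in u..v, Real.cosh ((x - L) / 2) ^ 2) -
        2 * p.re * (∫ x in u..v, Real.cosh (x / 2) * Real.cosh ((x - L) / 2)) +
        ‖p‖ ^ 2 * (∫ x in u..v, Real.cosh (x / 2) ^ 2) ∧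
    (∫ x in u..v, ‖(Real.cosh ((x - 2 * L) / 2) : ℂ) - s * (Real.cosh ((x - L) / 2) : ℂ) +
        (p * s - r) * (Real.cosh (x / 2) : ℂ)‖ ^ 2) =
      (∫ x in u..v, Real.cosh ((x - 2 * L) / 2) ^ 2) +
        ‖s‖ ^ 2 * (∫ x in u..v, Real.cosh ((x - L) / 2) ^ 2) +
        ‖p * s - r‖ ^ 2 * (∫ x in u..v, Real.cosh (x / 2) ^ 2) -
        2 * s.re * (∫ x in u..v, Real.cosh ((x - L) / 2) * Real.cosh ((x - 2 * L) / 2)) +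
        2 * (p * s - r).re * (∫ x in u..v, Real.cosh (x / 2) * Real.cosh ((x - 2 * L) / 2)) -
        2 * (s * conj (p * s - r)).re * (∫ x in u..v, Real.cosh (x / 2) * Real.cosh ((x - L) / 2)) := by
  have k11 : IntervalIntegrable (fun x ↦ Real.cosh (x / 2) ^ 2) volume u v :=
    (by fun_prop : Continuous fun x ↦ Real.cosh (x / 2) ^ 2).intervalIntegrable _ _
  have k22 : IntervalIntegrable (fun x ↦ Real.cosh ((x - L) / 2) ^ 2) volume u v :=
    (by fun_prop : Continuous fun x ↦ Real.cosh ((x - L) / 2) ^ 2).intervalIntegrable _ _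
  have k33 : IntervalIntegrable (fun x ↦ Real.cosh ((x - 2 * L) / 2) ^ 2) volume u v :=
    (by fun_prop : Continuous fun x ↦ Real.cosh ((x - 2 * L) / 2) ^ 2).intervalIntegrable _ _
  have k12 : IntervalIntegrable (fun x ↦ Real.cosh (x / 2) * Real.cosh ((x - L) / 2)) volume u v :=
    (by fun_prop : Continuous fun x ↦ Real.cosh (x / 2) * Real.cosh ((x - L) / 2)).intervalIntegrable _ _
  have k13 : IntervalIntegrable (fun x ↦ Real.cosh (x / 2) * Real.cosh ((x - 2 * L) / 2)) volume u v :=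
    (by fun_prop : Continuous fun x ↦
      Real.cosh (x / 2) * Real.cosh ((x - 2 * L) / 2)).intervalIntegrable _ _
  have k23 : IntervalIntegrable (fun x ↦ Real.cosh ((x - L) / 2) * Real.cosh ((x - 2 * L) / 2))
      volume u v :=
    (by fun_prop : Continuous fun x ↦
      Real.cosh ((x - L) / 2) * Real.cosh ((x - 2 * L) / 2)).intervalIntegrable _ _
  refine ⟨?_, ?_, ?_⟩
  · refine intervalIntegral.integral_congr fun x _ ↦ ?_
    simp only [Complex.norm_real, Real.norm_eq_abs, sq_abs]
  · have : (∫ x in u..v, ‖(Real.cosh ((x - L) / 2) : ℂ) - p * (Real.cosh (x / 2) : ℂ)‖ ^ 2) =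
        ∫ x in u..v, (Real.cosh ((x - L) / 2) ^ 2 -
          2 * p.re * (Real.cosh (x / 2) * Real.cosh ((x - L) / 2)) + ‖p‖ ^ 2 * Real.cosh (x / 2) ^ 2) :=
      intervalIntegral.integral_congr fun x _ ↦ normSq_dual_two p _ _
    rw [this, intervalIntegral.integral_add (k22.sub (k12.const_mul _)) (k11.const_mul _),
      intervalIntegral.integral_sub k22 (k12.const_mul _), intervalIntegral.integral_const_mul,
      intervalIntegral.integral_const_mul]
  · have : (∫ x in u..v, ‖(Real.cosh ((x - 2 * L) / 2) : ℂ) - s * (Real.cosh ((x - L) / 2) : ℂ) +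
        (p * s - r) * (Real.cosh (x / 2) : ℂ)‖ ^ 2) =
        ∫ x in u..v, (Real.cosh ((x - 2 * L) / 2) ^ 2 +
          ‖s‖ ^ 2 * Real.cosh ((x - L) / 2) ^ 2 + ‖p * s - r‖ ^ 2 * Real.cosh (x / 2) ^ 2 -
          2 * s.re * (Real.cosh ((x - L) / 2) * Real.cosh ((x - 2 * L) / 2)) +
          2 * (p * s - r).re * (Real.cosh (x / 2) * Real.cosh ((x - 2 * L) / 2)) -
          2 * (s * conj (p * s - r)).re * (Real.cosh (x / 2) * Real.cosh ((x - L) / 2))) :=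
      intervalIntegral.integral_congr fun x _ ↦ normSq_dual_three s (p * s - r) _ _ _
    rw [this, intervalIntegral.integral_sub ((((k33.add (k22.const_mul _)).add (k11.const_mul _)).sub
        (k23.const_mul _)).add (k13.const_mul _)) (k12.const_mul _),
      intervalIntegral.integral_add (((k33.add (k22.const_mul _)).add (k11.const_mul _)).sub
        (k23.const_mul _)) (k13.const_mul _),
      intervalIntegral.integral_sub ((k33.add (k22.const_mul _)).add (k11.const_mul _)) (k23.const_mul _),
      intervalIntegral.integral_add (k33.add (k22.const_mul _)) (k11.const_mul _),
      intervalIntegral.integral_add k33 (k22.const_mul _),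
      intervalIntegral.integral_const_mul, intervalIntegral.integral_const_mul,
      intervalIntegral.integral_const_mul, intervalIntegral.integral_const_mul,
      intervalIntegral.integral_const_mul]

/-! ## The reflection inequality beyond the shift -/

/-- **The reflection inequality beyond the shift** (`0 < L ≤ a`, `2a < 3L`; see the module docstring):
`0 ≤ W` and `|c|² ≤ W·G`, `W = B‖g‖² + 2κRe(ω k(L)) + 2κ'Re(ω' k(2L))`. [folklore] -/
theorem reflection_inequality_beyond (hg : IsWeilTest g) {L a : ℝ} (hsupp : tsupport g ⊆ Icc (-a) a)
    (hL : 0 < L) (hLa : L ≤ a) (h3L : 2 * a < 3 * L) {ω ω' : ℂ} (hω : ‖ω‖ = 1)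
    {κ κ' B : ℝ} (hκ : 0 ≤ κ) (hκB : κ < B)
    {d₂ d₃ : ℝ} (hd₂ : 0 < d₂) (hd₃ : 0 < d₃) {p r s : ℂ}
    (hI : B * ‖p‖ ^ 2 + d₂ = B) (hII : B * ‖r‖ ^ 2 + d₂ * ‖s‖ ^ 2 + d₃ = B)
    (hIII : (B : ℂ) * conj p = κ * ω) (hIV : (B : ℂ) * conj r = κ' * ω')
    (hV : (B : ℂ) * p * conj r + d₂ * conj s = κ * ω)
    {m' CP IP J11 J22 J33 J12 J13 J23 : ℝ} (hm' : m' = 2 * L - a)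
    (hCP : CP = ∫ x in (a - L)..m', Real.cosh (x / 2) ^ 2)
    (hIP : IP = ∫ x in (a - L)..m', Real.cosh (x / 2) * Real.cosh ((L - x) / 2))
    (hJ11 : J11 = ∫ x in m'..a, Real.cosh (x / 2) ^ 2)
    (hJ22 : J22 = ∫ x in m'..a, Real.cosh ((x - L) / 2) ^ 2)
    (hJ33 : J33 = ∫ x in m'..a, Real.cosh ((x - 2 * L) / 2) ^ 2)
    (hJ12 : J12 = ∫ x in m'..a, Real.cosh (x / 2) * Real.cosh ((x - L) / 2))
    (hJ13 : J13 = ∫ x in m'..a, Real.cosh (x / 2) * Real.cosh ((x - 2 * L) / 2))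
    (hJ23 : J23 = ∫ x in m'..a, Real.cosh ((x - L) / 2) * Real.cosh ((x - 2 * L) / 2)) :
    0 ≤ B * (∫ x, ‖g x‖ ^ 2) + 2 * κ * (ω * weilConv g (weilReflect g) L).re +
        2 * κ' * (ω' * weilConv g (weilReflect g) (2 * L)).re ∧
    ‖∫ x, g x * (Real.cosh (x / 2) : ℂ)‖ ^ 2 ≤
      (B * (∫ x, ‖g x‖ ^ 2) + 2 * κ * (ω * weilConv g (weilReflect g) L).re +
          2 * κ' * (ω' * weilConv g (weilReflect g) (2 * L)).re) *
        ((CP + ω.re * IP) / (B + κ) + (CP - ω.re * IP) / (B - κ) +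
          (J11 / B + (J22 - 2 * p.re * J12 + ‖p‖ ^ 2 * J11) / d₂ +
            (J33 + ‖s‖ ^ 2 * J22 + ‖p * s - r‖ ^ 2 * J11 - 2 * s.re * J23 + 2 * (p * s - r).re * J13 -
              2 * (s * conj (p * s - r)).re * J12) / d₃)) := by
  have hB : 0 < B := lt_of_le_of_lt hκ hκB
  have hBp : 0 < B + κ := by linarith
  have hBm : 0 < B - κ := by linarith
  have hgc : Continuous g := hg.1.continuous
  obtain ⟨hW0, hsq⟩ := reflection_beyond_core hg hsupp hL hLa h3L hω p r s hBp hBm hB hd₂ hd₃ hm'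
  have hWeq := pair_energy_identity hgc hω L (a - L) m' B κ
  have hUeq := triple_energy_identity hgc hI hII hIII hIV hV L m' a
  have hKA := re_mul_weilConv_split hg hsupp hLa h3L ω hm'
  have hKB := re_mul_weilConv_two_shift hg hsupp hLa ω' hm'
  have hN := normSq_integral_split_five hg hsupp hL hLa hm'
  have hE := pair_dual_identity hω (L := L) (u := a - L) (v := m') (by rw [hm']; ring)
  obtain ⟨hZ1, hZ2, hZ3⟩ := triple_dual_identity p r s L m' a
  have hW : ((B + κ) * (∫ x in (a - L)..m', ‖ω * g x + g (x - L)‖ ^ 2) +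
          (B - κ) * (∫ x in (a - L)..m', ‖ω * g x - g (x - L)‖ ^ 2)) / 2 +
        (B * (∫ x in m'..a, ‖g x + p * g (x - L) + r * g (x - 2 * L)‖ ^ 2) +
          d₂ * (∫ x in m'..a, ‖g (x - L) + s * g (x - 2 * L)‖ ^ 2) +
          d₃ * (∫ x in m'..a, ‖g (x - 2 * L)‖ ^ 2)) =
      B * (∫ x, ‖g x‖ ^ 2) + 2 * κ * (ω * weilConv g (weilReflect g) L).re +
        2 * κ' * (ω' * weilConv g (weilReflect g) (2 * L)).re := by
    rw [hWeq, hUeq, ← hKA, ← hKB, hN]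
    ring
  have hG : ((∫ x in (a - L)..m', ‖conj ω * (Real.cosh (x / 2) : ℂ) + (Real.cosh ((L - x) / 2) : ℂ)‖ ^ 2) /
            (B + κ) +
          (∫ x in (a - L)..m', ‖conj ω * (Real.cosh (x / 2) : ℂ) - (Real.cosh ((L - x) / 2) : ℂ)‖ ^ 2) /
            (B - κ)) / 2 +
        ((∫ x in m'..a, ‖(Real.cosh (x / 2) : ℂ)‖ ^ 2) / B +
          (∫ x in m'..a, ‖(Real.cosh ((x - L) / 2) : ℂ) - p * (Real.cosh (x / 2) : ℂ)‖ ^ 2) / d₂ +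
          (∫ x in m'..a, ‖(Real.cosh ((x - 2 * L) / 2) : ℂ) - s * (Real.cosh ((x - L) / 2) : ℂ) +
            (p * s - r) * (Real.cosh (x / 2) : ℂ)‖ ^ 2) / d₃) =
      (CP + ω.re * IP) / (B + κ) + (CP - ω.re * IP) / (B - κ) +
        (J11 / B + (J22 - 2 * p.re * J12 + ‖p‖ ^ 2 * J11) / d₂ +
          (J33 + ‖s‖ ^ 2 * J22 + ‖p * s - r‖ ^ 2 * J11 - 2 * s.re * J23 + 2 * (p * s - r).re * J13 -
            2 * (s * conj (p * s - r)).re * J12) / d₃) := by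
    rw [hE.1, hE.2, hZ1, hZ2, hZ3, hCP, hIP, hJ11, hJ22, hJ33, hJ12, hJ13, hJ23]
    ring
  rw [hW] at hW0 hsq
  rw [hG] at hsq
  exact ⟨hW0, hsq⟩

end Summit.Ventures.WeilGRH
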